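import Summits.QuantumFields.YangMills.Theorems.BalabanLadderNTStrongCouplingProductObsCumulant
import Summits.QuantumFields.YangMills.Theorems.ConvexGribovBodyContinuumLegGivenGapStubRpShift
import Summits.QuantumFields.YangMills.Theorems.ScalingWindowSplitSelfNormalisedSkewnessWitnessCumulants
import HarnessLib

/-!
# Crux `NT` (stmt-QuantumFields-19353), strong-coupling rung: algebra of the five-term third cumulant
# (constant slots, shifts, finite sums, slot symmetry, finite sums of jets)

Helper file of ym-idea-8 (g5, lens "dual"; instrument F4d for the NT non-Gaussian first rung `SkewFloorSU2`,
`Cruxes/NT/Lines/strong_coupling_rung.lean`, LEAD `ym-spine-19353-p1` g17 item (D)).  The rung's third cumulant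
`torusK3` / its free-boundary analogue is the five-term expression
`K₃(X,Y,Z) = E[XYZ] − E[X]E[YZ] − E[Y]E[XZ] − E[Z]E[XY] + 2E[X]E[Y]E[Z]` of three SUMS `dens x = Σ_q φ_{(x,q)}` of
six plaquette observables each.  To feed the plaquette-triple jets of `…ProductObsCumulant` / `…CubeCumulant` /
`…ProductObsCounting` into LEAD's free door `torusK3_floor_of_freeJet` one needs the bookkeeping typed here, for
an arbitrary probability measure `μ` (all expectations are `∫ · ∂μ`; no definition is introduced):

* `k3_const_left/mid/right` — a constant slot kills `K₃` (no integrability needed);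
* `k3_add_const` — shift invariance `K₃(F + a, G + b, H + c) = K₃(F, G, H)` (bounded measurable slots);
* `k3_sum_left/mid/right` — additivity of `K₃` in each slot over a finite sum (integrable summands);
* `k3_swap23`, `k3_swap13` — slot symmetry;
* `exists_bound_finset_sum` — a finite sum of `O(|t|ⁿ)`-jets near `0` is an `O(|t|ⁿ)`-jet;
* `isBigO_of_bound` — packaging `|g t| ≤ C|t|ⁿ (|t| ≤ β₀)` as `g =O[𝓝 0] tⁿ`.

HONEST FRAMING: elementary probability bookkeeping; nothing about Yang–Mills is proved here; NT `0/1`; no summit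
is proved by a line.  [folklore]
-/

noncomputable section

open MeasureTheory Filter Topology Asymptotics

open Summit.QuantumFields.YangMills.Theorems.ContinuumLegGivenGap (rpShift_integrable_mul)
open Summit.QuantumFields.YangMills.Theorems.SelfNormalisedSkewness.Negative (integrable_of_abs_le_const)

namespace Summit.QuantumFields.YangMills.Cruxes.NT.StrongCouplingRung.CumulantAlgebra

variable {Ω : Type*} [MeasurableSpace Ω] {μ : Measure Ω}

/-! ### Integrability of bounded measurable functions and their products -/

-- bounded measurable functions and products of two of them are integrable: the tree's
-- `SelfNormalisedSkewness.Negative.integrable_of_abs_le_const` and `ContinuumLegGivenGap.rpShift_integrable_mul`.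

/-- Products of three bounded measurable functions are integrable for a finite measure. [folklore] -/
theorem integrable_mul₃_of_bdd [IsFiniteMeasure μ] {F G H : Ω → ℝ} (hF : Measurable F) (hG : Measurable G)
    (hH : Measurable H) {M N P : ℝ} (hM : ∀ ω, |F ω| ≤ M) (hN : ∀ ω, |G ω| ≤ N) (hP : ∀ ω, |H ω| ≤ P) :
    Integrable (fun ω => F ω * G ω * H ω) μ :=
  Integrable.of_bound ((hF.mul hG).mul hH).aestronglyMeasurable (M * N * P) (ae_of_all _ fun ω => by
    rw [Real.norm_eq_abs, abs_mul, abs_mul]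
    have h0 : 0 ≤ M := (abs_nonneg _).trans (hM ω)
    exact mul_le_mul (mul_le_mul (hM ω) (hN ω) (abs_nonneg _) h0) (hP ω) (abs_nonneg _)
      (mul_nonneg h0 ((abs_nonneg _).trans (hN ω))))

/-! ### A constant slot kills the third cumulant -/

/-- `K₃(a, G, H) = 0` for a constant first slot. [folklore] -/
theorem k3_const_left [IsProbabilityMeasure μ] (a : ℝ) (G H : Ω → ℝ) :
    (∫ ω, a * G ω * H ω ∂μ) - (∫ _ω, a ∂μ) * (∫ ω, G ω * H ω ∂μ) - (∫ ω, G ω ∂μ) * (∫ ω, a * H ω ∂μ) -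
        (∫ ω, H ω ∂μ) * (∫ ω, a * G ω ∂μ) + 2 * ((∫ _ω, a ∂μ) * (∫ ω, G ω ∂μ) * (∫ ω, H ω ∂μ)) = 0 := by
  have h1 : ∫ ω, a * G ω * H ω ∂μ = a * ∫ ω, G ω * H ω ∂μ := by
    rw [← integral_const_mul]; congr 1; funext ω; ring
  rw [h1, integral_const_mul, integral_const_mul, integral_const, probReal_univ, one_smul]
  ring

/-- `K₃(F, b, H) = 0` for a constant middle slot. [folklore] -/
theorem k3_const_mid [IsProbabilityMeasure μ] (b : ℝ) (F H : Ω → ℝ) :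
    (∫ ω, F ω * b * H ω ∂μ) - (∫ ω, F ω ∂μ) * (∫ ω, b * H ω ∂μ) - (∫ _ω, b ∂μ) * (∫ ω, F ω * H ω ∂μ) -
        (∫ ω, H ω ∂μ) * (∫ ω, F ω * b ∂μ) + 2 * ((∫ ω, F ω ∂μ) * (∫ _ω, b ∂μ) * (∫ ω, H ω ∂μ)) = 0 := by
  have h1 : ∫ ω, F ω * b * H ω ∂μ = b * ∫ ω, F ω * H ω ∂μ := by
    rw [← integral_const_mul]; congr 1; funext ω; ring
  have h2 : ∫ ω, F ω * b ∂μ = b * ∫ ω, F ω ∂μ := by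
    rw [← integral_const_mul]; congr 1; funext ω; ring
  rw [h1, h2, integral_const_mul, integral_const, probReal_univ, one_smul]
  ring

/-- `K₃(F, G, c) = 0` for a constant last slot. [folklore] -/
theorem k3_const_right [IsProbabilityMeasure μ] (c : ℝ) (F G : Ω → ℝ) :
    (∫ ω, F ω * G ω * c ∂μ) - (∫ ω, F ω ∂μ) * (∫ ω, G ω * c ∂μ) - (∫ ω, G ω ∂μ) * (∫ ω, F ω * c ∂μ) -
        (∫ _ω, c ∂μ) * (∫ ω, F ω * G ω ∂μ) + 2 * ((∫ ω, F ω ∂μ) * (∫ ω, G ω ∂μ) * (∫ _ω, c ∂μ)) = 0 := by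
  rw [integral_mul_const, integral_mul_const, integral_mul_const, integral_const, probReal_univ, one_smul]
  ring

/-! ### Shift invariance -/

/-- **Shift invariance of the third cumulant**: `K₃(F + a, G + b, H + c) = K₃(F, G, H)` for bounded measurable
`F, G, H` under a probability measure. [folklore] -/
theorem k3_add_const [IsProbabilityMeasure μ] {F G H : Ω → ℝ} (hF : Measurable F) (hG : Measurable G)
    (hH : Measurable H) {M : ℝ} (hFb : ∀ ω, |F ω| ≤ M) (hGb : ∀ ω, |G ω| ≤ M) (hHb : ∀ ω, |H ω| ≤ M)
    (a b c : ℝ) :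
    (∫ ω, (F ω + a) * (G ω + b) * (H ω + c) ∂μ) -
        (∫ ω, (F ω + a) ∂μ) * (∫ ω, (G ω + b) * (H ω + c) ∂μ) -
        (∫ ω, (G ω + b) ∂μ) * (∫ ω, (F ω + a) * (H ω + c) ∂μ) -
        (∫ ω, (H ω + c) ∂μ) * (∫ ω, (F ω + a) * (G ω + b) ∂μ) +
        2 * ((∫ ω, (F ω + a) ∂μ) * (∫ ω, (G ω + b) ∂μ) * (∫ ω, (H ω + c) ∂μ)) =
      (∫ ω, F ω * G ω * H ω ∂μ) - (∫ ω, F ω ∂μ) * (∫ ω, G ω * H ω ∂μ) -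
        (∫ ω, G ω ∂μ) * (∫ ω, F ω * H ω ∂μ) - (∫ ω, H ω ∂μ) * (∫ ω, F ω * G ω ∂μ) +
        2 * ((∫ ω, F ω ∂μ) * (∫ ω, G ω ∂μ) * (∫ ω, H ω ∂μ)) := by
  have iF : Integrable F μ := integrable_of_abs_le_const hF hFb
  have iG : Integrable G μ := integrable_of_abs_le_const hG hGb
  have iH : Integrable H μ := integrable_of_abs_le_const hH hHb
  have iFG : Integrable (fun ω => F ω * G ω) μ := rpShift_integrable_mul hF hG hFb hGb
  have iFH : Integrable (fun ω => F ω * H ω) μ := rpShift_integrable_mul hF hH hFb hHb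
  have iGH : Integrable (fun ω => G ω * H ω) μ := rpShift_integrable_mul hG hH hGb hHb
  have iFGH : Integrable (fun ω => F ω * G ω * H ω) μ := integrable_mul₃_of_bdd hF hG hH hFb hGb hHb
  -- expansions of the shifted expectations
  have e1 : ∫ ω, (F ω + a) ∂μ = (∫ ω, F ω ∂μ) + a := by
    rw [integral_add iF (integrable_const a), integral_const, probReal_univ, one_smul]
  have e2 : ∫ ω, (G ω + b) ∂μ = (∫ ω, G ω ∂μ) + b := by
    rw [integral_add iG (integrable_const b), integral_const, probReal_univ, one_smul]
  have e3 : ∫ ω, (H ω + c) ∂μ = (∫ ω, H ω ∂μ) + c := by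
    rw [integral_add iH (integrable_const c), integral_const, probReal_univ, one_smul]
  have e4 : ∫ ω, (G ω + b) * (H ω + c) ∂μ =
      (∫ ω, G ω * H ω ∂μ) + c * (∫ ω, G ω ∂μ) + b * (∫ ω, H ω ∂μ) + b * c := by
    have e : (fun ω => (G ω + b) * (H ω + c)) =
        fun ω => G ω * H ω + c * G ω + b * H ω + b * c := by funext ω; ring
    have s1 : Integrable (fun ω => G ω * H ω + c * G ω) μ := iGH.add (iG.const_mul c)
    have s2 : Integrable (fun ω => G ω * H ω + c * G ω + b * H ω) μ := s1.add (iH.const_mul b)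
    rw [e, integral_add s2 (integrable_const _), integral_add s1 (iH.const_mul b),
      integral_add iGH (iG.const_mul c), integral_const_mul, integral_const_mul, integral_const,
      probReal_univ, one_smul]
  have e5 : ∫ ω, (F ω + a) * (H ω + c) ∂μ =
      (∫ ω, F ω * H ω ∂μ) + c * (∫ ω, F ω ∂μ) + a * (∫ ω, H ω ∂μ) + a * c := by
    have e : (fun ω => (F ω + a) * (H ω + c)) =
        fun ω => F ω * H ω + c * F ω + a * H ω + a * c := by funext ω; ring
    have s1 : Integrable (fun ω => F ω * H ω + c * F ω) μ := iFH.add (iF.const_mul c)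
    have s2 : Integrable (fun ω => F ω * H ω + c * F ω + a * H ω) μ := s1.add (iH.const_mul a)
    rw [e, integral_add s2 (integrable_const _), integral_add s1 (iH.const_mul a),
      integral_add iFH (iF.const_mul c), integral_const_mul, integral_const_mul, integral_const,
      probReal_univ, one_smul]
  have e6 : ∫ ω, (F ω + a) * (G ω + b) ∂μ =
      (∫ ω, F ω * G ω ∂μ) + b * (∫ ω, F ω ∂μ) + a * (∫ ω, G ω ∂μ) + a * b := by
    have e : (fun ω => (F ω + a) * (G ω + b)) =
        fun ω => F ω * G ω + b * F ω + a * G ω + a * b := by funext ω; ring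
    have s1 : Integrable (fun ω => F ω * G ω + b * F ω) μ := iFG.add (iF.const_mul b)
    have s2 : Integrable (fun ω => F ω * G ω + b * F ω + a * G ω) μ := s1.add (iG.const_mul a)
    rw [e, integral_add s2 (integrable_const _), integral_add s1 (iG.const_mul a),
      integral_add iFG (iF.const_mul b), integral_const_mul, integral_const_mul, integral_const,
      probReal_univ, one_smul]
  have e7 : ∫ ω, (F ω + a) * (G ω + b) * (H ω + c) ∂μ =
      (∫ ω, F ω * G ω * H ω ∂μ) + c * (∫ ω, F ω * G ω ∂μ) + b * (∫ ω, F ω * H ω ∂μ) +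
        a * (∫ ω, G ω * H ω ∂μ) + b * c * (∫ ω, F ω ∂μ) + a * c * (∫ ω, G ω ∂μ) +
        a * b * (∫ ω, H ω ∂μ) + a * b * c := by
    have e : (fun ω => (F ω + a) * (G ω + b) * (H ω + c)) =
        fun ω => F ω * G ω * H ω + c * (F ω * G ω) + b * (F ω * H ω) + a * (G ω * H ω) +
          b * c * F ω + a * c * G ω + a * b * H ω + a * b * c := by funext ω; ring
    have s1 : Integrable (fun ω => F ω * G ω * H ω + c * (F ω * G ω)) μ := iFGH.add (iFG.const_mul c)
    have s2 : Integrable (fun ω => F ω * G ω * H ω + c * (F ω * G ω) + b * (F ω * H ω)) μ :=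
      s1.add (iFH.const_mul b)
    have s3 : Integrable (fun ω => F ω * G ω * H ω + c * (F ω * G ω) + b * (F ω * H ω) +
        a * (G ω * H ω)) μ := s2.add (iGH.const_mul a)
    have s4 : Integrable (fun ω => F ω * G ω * H ω + c * (F ω * G ω) + b * (F ω * H ω) +
        a * (G ω * H ω) + b * c * F ω) μ := s3.add (iF.const_mul (b * c))
    have s5 : Integrable (fun ω => F ω * G ω * H ω + c * (F ω * G ω) + b * (F ω * H ω) +
        a * (G ω * H ω) + b * c * F ω + a * c * G ω) μ := s4.add (iG.const_mul (a * c))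
    have s6 : Integrable (fun ω => F ω * G ω * H ω + c * (F ω * G ω) + b * (F ω * H ω) +
        a * (G ω * H ω) + b * c * F ω + a * c * G ω + a * b * H ω) μ := s5.add (iH.const_mul (a * b))
    rw [e, integral_add s6 (integrable_const _), integral_add s5 (iH.const_mul _),
      integral_add s4 (iG.const_mul _), integral_add s3 (iF.const_mul _), integral_add s2 (iGH.const_mul _),
      integral_add s1 (iFH.const_mul _), integral_add iFGH (iFG.const_mul _)]
    simp only [integral_const_mul, integral_const, probReal_univ, one_smul]
  rw [e1, e2, e3, e4, e5, e6, e7]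
  ring

/-! ### Additivity in each slot -/

/-- Additivity of `K₃` in the first slot over a finite sum. [folklore] -/
theorem k3_sum_left {ι : Type*} (s : Finset ι) (f : ι → Ω → ℝ) (G H : Ω → ℝ)
    (hf : ∀ i ∈ s, Integrable (f i) μ) (hfG : ∀ i ∈ s, Integrable (fun ω => f i ω * G ω) μ)
    (hfH : ∀ i ∈ s, Integrable (fun ω => f i ω * H ω) μ)
    (hfGH : ∀ i ∈ s, Integrable (fun ω => f i ω * G ω * H ω) μ) :
    (∫ ω, (∑ i ∈ s, f i ω) * G ω * H ω ∂μ) - (∫ ω, ∑ i ∈ s, f i ω ∂μ) * (∫ ω, G ω * H ω ∂μ) -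
        (∫ ω, G ω ∂μ) * (∫ ω, (∑ i ∈ s, f i ω) * H ω ∂μ) -
        (∫ ω, H ω ∂μ) * (∫ ω, (∑ i ∈ s, f i ω) * G ω ∂μ) +
        2 * ((∫ ω, ∑ i ∈ s, f i ω ∂μ) * (∫ ω, G ω ∂μ) * (∫ ω, H ω ∂μ)) =
      ∑ i ∈ s, ((∫ ω, f i ω * G ω * H ω ∂μ) - (∫ ω, f i ω ∂μ) * (∫ ω, G ω * H ω ∂μ) -
        (∫ ω, G ω ∂μ) * (∫ ω, f i ω * H ω ∂μ) - (∫ ω, H ω ∂μ) * (∫ ω, f i ω * G ω ∂μ) +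
        2 * ((∫ ω, f i ω ∂μ) * (∫ ω, G ω ∂μ) * (∫ ω, H ω ∂μ))) := by
  have e1 : ∫ ω, (∑ i ∈ s, f i ω) * G ω * H ω ∂μ = ∑ i ∈ s, ∫ ω, f i ω * G ω * H ω ∂μ := by
    rw [← integral_finsetSum s hfGH]; congr 1; funext ω; rw [Finset.sum_mul, Finset.sum_mul]
  have e2 : ∫ ω, ∑ i ∈ s, f i ω ∂μ = ∑ i ∈ s, ∫ ω, f i ω ∂μ := integral_finsetSum s hf
  have e3 : ∫ ω, (∑ i ∈ s, f i ω) * H ω ∂μ = ∑ i ∈ s, ∫ ω, f i ω * H ω ∂μ := by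
    rw [← integral_finsetSum s hfH]; congr 1; funext ω; rw [Finset.sum_mul]
  have e4 : ∫ ω, (∑ i ∈ s, f i ω) * G ω ∂μ = ∑ i ∈ s, ∫ ω, f i ω * G ω ∂μ := by
    rw [← integral_finsetSum s hfG]; congr 1; funext ω; rw [Finset.sum_mul]
  rw [e1, e2, e3, e4]
  simp only [Finset.sum_sub_distrib, Finset.sum_add_distrib, Finset.mul_sum, Finset.sum_mul]

/-- Additivity of `K₃` in the middle slot over a finite sum. [folklore] -/
theorem k3_sum_mid {ι : Type*} (s : Finset ι) (F : Ω → ℝ) (g : ι → Ω → ℝ) (H : Ω → ℝ)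
    (hg : ∀ i ∈ s, Integrable (g i) μ) (hFg : ∀ i ∈ s, Integrable (fun ω => F ω * g i ω) μ)
    (hgH : ∀ i ∈ s, Integrable (fun ω => g i ω * H ω) μ)
    (hFgH : ∀ i ∈ s, Integrable (fun ω => F ω * g i ω * H ω) μ) :
    (∫ ω, F ω * (∑ i ∈ s, g i ω) * H ω ∂μ) - (∫ ω, F ω ∂μ) * (∫ ω, (∑ i ∈ s, g i ω) * H ω ∂μ) -
        (∫ ω, ∑ i ∈ s, g i ω ∂μ) * (∫ ω, F ω * H ω ∂μ) -
        (∫ ω, H ω ∂μ) * (∫ ω, F ω * (∑ i ∈ s, g i ω) ∂μ) +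
        2 * ((∫ ω, F ω ∂μ) * (∫ ω, ∑ i ∈ s, g i ω ∂μ) * (∫ ω, H ω ∂μ)) =
      ∑ i ∈ s, ((∫ ω, F ω * g i ω * H ω ∂μ) - (∫ ω, F ω ∂μ) * (∫ ω, g i ω * H ω ∂μ) -
        (∫ ω, g i ω ∂μ) * (∫ ω, F ω * H ω ∂μ) - (∫ ω, H ω ∂μ) * (∫ ω, F ω * g i ω ∂μ) +
        2 * ((∫ ω, F ω ∂μ) * (∫ ω, g i ω ∂μ) * (∫ ω, H ω ∂μ))) := by
  have e1 : ∫ ω, F ω * (∑ i ∈ s, g i ω) * H ω ∂μ = ∑ i ∈ s, ∫ ω, F ω * g i ω * H ω ∂μ := by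
    rw [← integral_finsetSum s hFgH]; congr 1; funext ω; rw [Finset.mul_sum, Finset.sum_mul]
  have e2 : ∫ ω, ∑ i ∈ s, g i ω ∂μ = ∑ i ∈ s, ∫ ω, g i ω ∂μ := integral_finsetSum s hg
  have e3 : ∫ ω, (∑ i ∈ s, g i ω) * H ω ∂μ = ∑ i ∈ s, ∫ ω, g i ω * H ω ∂μ := by
    rw [← integral_finsetSum s hgH]; congr 1; funext ω; rw [Finset.sum_mul]
  have e4 : ∫ ω, F ω * (∑ i ∈ s, g i ω) ∂μ = ∑ i ∈ s, ∫ ω, F ω * g i ω ∂μ := by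
    rw [← integral_finsetSum s hFg]; congr 1; funext ω; rw [Finset.mul_sum]
  rw [e1, e2, e3, e4]
  simp only [Finset.sum_sub_distrib, Finset.sum_add_distrib, Finset.mul_sum, Finset.sum_mul]

/-- Additivity of `K₃` in the last slot over a finite sum. [folklore] -/
theorem k3_sum_right {ι : Type*} (s : Finset ι) (F G : Ω → ℝ) (h : ι → Ω → ℝ)
    (hh : ∀ i ∈ s, Integrable (h i) μ) (hFh : ∀ i ∈ s, Integrable (fun ω => F ω * h i ω) μ)
    (hGh : ∀ i ∈ s, Integrable (fun ω => G ω * h i ω) μ)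
    (hFGh : ∀ i ∈ s, Integrable (fun ω => F ω * G ω * h i ω) μ) :
    (∫ ω, F ω * G ω * (∑ i ∈ s, h i ω) ∂μ) - (∫ ω, F ω ∂μ) * (∫ ω, G ω * (∑ i ∈ s, h i ω) ∂μ) -
        (∫ ω, G ω ∂μ) * (∫ ω, F ω * (∑ i ∈ s, h i ω) ∂μ) -
        (∫ ω, ∑ i ∈ s, h i ω ∂μ) * (∫ ω, F ω * G ω ∂μ) +
        2 * ((∫ ω, F ω ∂μ) * (∫ ω, G ω ∂μ) * (∫ ω, ∑ i ∈ s, h i ω ∂μ)) =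
      ∑ i ∈ s, ((∫ ω, F ω * G ω * h i ω ∂μ) - (∫ ω, F ω ∂μ) * (∫ ω, G ω * h i ω ∂μ) -
        (∫ ω, G ω ∂μ) * (∫ ω, F ω * h i ω ∂μ) - (∫ ω, h i ω ∂μ) * (∫ ω, F ω * G ω ∂μ) +
        2 * ((∫ ω, F ω ∂μ) * (∫ ω, G ω ∂μ) * (∫ ω, h i ω ∂μ))) := by
  have e1 : ∫ ω, F ω * G ω * (∑ i ∈ s, h i ω) ∂μ = ∑ i ∈ s, ∫ ω, F ω * G ω * h i ω ∂μ := by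
    rw [← integral_finsetSum s hFGh]; congr 1; funext ω; rw [Finset.mul_sum]
  have e2 : ∫ ω, ∑ i ∈ s, h i ω ∂μ = ∑ i ∈ s, ∫ ω, h i ω ∂μ := integral_finsetSum s hh
  have e3 : ∫ ω, G ω * (∑ i ∈ s, h i ω) ∂μ = ∑ i ∈ s, ∫ ω, G ω * h i ω ∂μ := by
    rw [← integral_finsetSum s hGh]; congr 1; funext ω; rw [Finset.mul_sum]
  have e4 : ∫ ω, F ω * (∑ i ∈ s, h i ω) ∂μ = ∑ i ∈ s, ∫ ω, F ω * h i ω ∂μ := by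
    rw [← integral_finsetSum s hFh]; congr 1; funext ω; rw [Finset.mul_sum]
  rw [e1, e2, e3, e4]
  simp only [Finset.sum_sub_distrib, Finset.sum_add_distrib, Finset.mul_sum, Finset.sum_mul]

/-! ### Slot symmetry -/

/-- Slot symmetry of `K₃`: swapping the last two slots. [folklore] -/
theorem k3_swap23 (F G H : Ω → ℝ) :
    (∫ ω, F ω * G ω * H ω ∂μ) - (∫ ω, F ω ∂μ) * (∫ ω, G ω * H ω ∂μ) -
        (∫ ω, G ω ∂μ) * (∫ ω, F ω * H ω ∂μ) - (∫ ω, H ω ∂μ) * (∫ ω, F ω * G ω ∂μ) +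
        2 * ((∫ ω, F ω ∂μ) * (∫ ω, G ω ∂μ) * (∫ ω, H ω ∂μ)) =
      (∫ ω, F ω * H ω * G ω ∂μ) - (∫ ω, F ω ∂μ) * (∫ ω, H ω * G ω ∂μ) -
        (∫ ω, H ω ∂μ) * (∫ ω, F ω * G ω ∂μ) - (∫ ω, G ω ∂μ) * (∫ ω, F ω * H ω ∂μ) +
        2 * ((∫ ω, F ω ∂μ) * (∫ ω, H ω ∂μ) * (∫ ω, G ω ∂μ)) := by
  have e1 : (fun ω => F ω * H ω * G ω) = fun ω => F ω * G ω * H ω := by funext ω; ring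
  have e2 : (fun ω => H ω * G ω) = fun ω => G ω * H ω := by funext ω; ring
  rw [e1, e2]
  ring

/-- Slot symmetry of `K₃`: swapping the first and last slots. [folklore] -/
theorem k3_swap13 (F G H : Ω → ℝ) :
    (∫ ω, F ω * G ω * H ω ∂μ) - (∫ ω, F ω ∂μ) * (∫ ω, G ω * H ω ∂μ) -
        (∫ ω, G ω ∂μ) * (∫ ω, F ω * H ω ∂μ) - (∫ ω, H ω ∂μ) * (∫ ω, F ω * G ω ∂μ) +
        2 * ((∫ ω, F ω ∂μ) * (∫ ω, G ω ∂μ) * (∫ ω, H ω ∂μ)) =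
      (∫ ω, H ω * G ω * F ω ∂μ) - (∫ ω, H ω ∂μ) * (∫ ω, G ω * F ω ∂μ) -
        (∫ ω, G ω ∂μ) * (∫ ω, H ω * F ω ∂μ) - (∫ ω, F ω ∂μ) * (∫ ω, H ω * G ω ∂μ) +
        2 * ((∫ ω, H ω ∂μ) * (∫ ω, G ω ∂μ) * (∫ ω, F ω ∂μ)) := by
  have e1 : (fun ω => H ω * G ω * F ω) = fun ω => F ω * G ω * H ω := by funext ω; ring
  have e2 : (fun ω => G ω * F ω) = fun ω => F ω * G ω := by funext ω; ring
  have e3 : (fun ω => H ω * F ω) = fun ω => F ω * H ω := by funext ω; ring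
  have e4 : (fun ω => H ω * G ω) = fun ω => G ω * H ω := by funext ω; ring
  rw [e1, e2, e3, e4]
  ring

/-! ### Finite sums of jets -/

/-- A finite sum of functions each bounded by `Cᵢ |t|ⁿ` on `|t| ≤ βᵢ` is bounded by `C |t|ⁿ` on a common
neighbourhood of `0`. [folklore] -/
theorem exists_bound_finset_sum {ι : Type*} (s : Finset ι) (g : ι → ℝ → ℝ) (n : ℕ)
    (h : ∀ i ∈ s, ∃ C β₀ : ℝ, 0 < β₀ ∧ ∀ t : ℝ, |t| ≤ β₀ → |g i t| ≤ C * |t| ^ n) :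
    ∃ C β₀ : ℝ, 0 < β₀ ∧ ∀ t : ℝ, |t| ≤ β₀ → |∑ i ∈ s, g i t| ≤ C * |t| ^ n := by
  classical
  induction s using Finset.induction_on with
  | empty => exact ⟨0, 1, one_pos, fun t _ => by simp⟩
  | @insert a s ha ih =>
    obtain ⟨C₁, β₁, hβ₁, h₁⟩ := h a (Finset.mem_insert_self _ _)
    obtain ⟨C₂, β₂, hβ₂, h₂⟩ := ih fun i hi => h i (Finset.mem_insert_of_mem hi)
    refine ⟨C₁ + C₂, min β₁ β₂, lt_min hβ₁ hβ₂, fun t ht => ?_⟩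
    rw [Finset.sum_insert ha]
    calc |g a t + ∑ i ∈ s, g i t| ≤ |g a t| + |∑ i ∈ s, g i t| := abs_add_le _ _
      _ ≤ C₁ * |t| ^ n + C₂ * |t| ^ n :=
          add_le_add (h₁ t (ht.trans (min_le_left _ _))) (h₂ t (ht.trans (min_le_right _ _)))
      _ = (C₁ + C₂) * |t| ^ n := by ring

/-- Packaging: `|g t| ≤ C |t|ⁿ` for `|t| ≤ β₀` (`β₀ > 0`) gives `g =O[𝓝 0] tⁿ`. [folklore] -/
theorem isBigO_of_bound {g : ℝ → ℝ} {n : ℕ}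
    (h : ∃ C β₀ : ℝ, 0 < β₀ ∧ ∀ t : ℝ, |t| ≤ β₀ → |g t| ≤ C * |t| ^ n) :
    g =O[𝓝 0] fun t : ℝ => t ^ n := by
  obtain ⟨C, β₀, hβ₀, hC⟩ := h
  refine Asymptotics.IsBigO.of_bound C ?_
  have hmem : Metric.ball (0 : ℝ) β₀ ∈ 𝓝 (0 : ℝ) := Metric.ball_mem_nhds 0 hβ₀
  filter_upwards [hmem] with t ht
  rw [Metric.mem_ball, dist_zero_right, Real.norm_eq_abs] at ht
  rw [Real.norm_eq_abs, Real.norm_eq_abs, abs_pow]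
  exact hC t ht.le

end Summit.QuantumFields.YangMills.Cruxes.NT.StrongCouplingRung.CumulantAlgebra

end
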